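import Summits.BirchSwinnertonDyer.BirchSwinnertonDyer.Theorems.ManinLocalTwoThreeRelativeIharaShiftVanishingBarHolds
import Summits.BirchSwinnertonDyer.BirchSwinnertonDyer.Theorems.ManinLocalTwoThreeBoundaryAnnihilator
import Summits.BirchSwinnertonDyer.BirchSwinnertonDyer.Theorems.ManinLocalTwoThreeSymbolHeckeDictionary
import HarnessLib

/-!
# Crux `MazurTateCongruenceAtTwoTop` (stmt-BirchSwinnertonDyer-25797 = `MazurTateCongruenceAtTwoR` 21416), line `symbol`:
# DILATION-INVARIANT non-Eisenstein Hecke eigen-symbols VANISH — Ihara's lemma at every residue characteristic for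
# `Γ₀(N)`-symbol functions on `ℚ`, imported from cell bsd-f2-manin's relative Ihara theorem
# (width seat bsd-wall-tp2-p1-w3 g0; `--supports stmt-BirchSwinnertonDyer-25797`; closes nothing)

HONEST FRAMING. THEOREMS ONLY (no `def`, no named fact, no `sorry`); nothing about any curve, form or about BSD is asserted.

WHY (K1 row, skeleton `symbol` v3). The crux is the plus line (PUB⁴) + the period fact + `Hμ(E)` («the `S₀`-DEPLETED
Néron-normalised plus table of `E` attains norm `2` somewhere on `ℚ`») for both curves of a theta pair
(`mazurTateCongruenceAtTwoTop_of_fourFacts_mu`, pointwise `mazurTateCongruence_of_plusLine`). The UNDEPLETED table attains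
`2` at the Manin cusp `1/2`, so `Hμ(E)` is an UN-DEPLETION statement: `∏_{v∈S₀} (1 − a_ℓ ℓ⁻¹[ℓ] + 𝟙 ℓ⁻¹[ℓ²])` must not kill
the mod-`2` plus symbol. Mod `2` every factor is `1 + c₁[ℓ] + c₂[ℓ²]`, `cᵢ ∈ {0,1}`, and `(1 + c₁B + c₂B²) ∣ (1 + Bⁿ)` in
`𝔽₂[B]` for some `n ∈ {1,2,3}`; so a killed symbol is DILATION-INVARIANT. THIS FILE: a dilation-invariant
`Γ₀(N)`-symbol function `Φ : ℚ → K` (`char K = p` arbitrary) which is a Hecke eigenfunction with a NON-Eisenstein system is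
`0` — the cocycle `γ ↦ Φ̃(γ∞)` is shift-invariant, hence `0` by cell bsd-f2-manin's
`ManinLocalTwoThree.relativeIharaShiftVanishingBar_holds p t n` (proved there through the congruence subgroup property of
`SL₂(ℤ[1/t])`), so the symbol is a boundary symbol (`exists_boundary_of_delta_eq_zero`) and non-Eisenstein boundary
eigensymbols vanish (`boundary_gen_eigen_eq_zero_finset`, E-es-30).
* §1 the cusp symbol `(a,b) ↦ Φ̃(b) − Φ̃(a)` of a `Γ₀(N)`-symbol function (Manin's relation in the inline shape of
  `ratPlusSymbol_gamma0_smul`) is `Γ₀(N)`-invariant on `OnePoint ℚ` (`elim_mapGL_smul`, pole included);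
* §2 Hecke sums over `heckeRepGL` are the `T_q`-sums `∑_{j<q} Φ((r+j)/q) + Φ(qr)` (`sum_heckeIdx_elim_smul`);
* §3 `eq_zero_of_dilationInvariant` (MAIN); §4 `exists_ne_zero_depletionFactor` (char `2` un-depletion step).

References: K. Ribet, Proc. ICM 1983 (1984) Thm. 4.1 (Ihara's lemma, shape); R. Greenberg, V. Vatsal, Invent. Math. 142
(2000) §3 (un-depletion via Ihara, `p` odd); cell bsd-f2-manin memo MEMO-es §21–§23; G. Stevens (1982) Ch. 1.
-/

-- justification: the `Summit.BirchSwinnertonDyer.BirchSwinnertonDyer.…` path repeats a component (route-file convention)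
set_option linter.dupNamespace false
set_option autoImplicit false

noncomputable section

open scoped MatrixGroups

open CongruenceSubgroup Matrix.SpecialLinearGroup Literature.NumberTheory.EllipticCurves.ModularForms
  Literature.NumberTheory.EllipticCurves.ModularForms.HidaCohomology
  Summit.BirchSwinnertonDyer.BirchSwinnertonDyer.Theorems.ManinLocalTwoThree

namespace Summit.BirchSwinnertonDyer.BirchSwinnertonDyer.Theorems.MazurTateCongruenceAtTwoR

/-! ## §1. From a `Γ₀(N)`-symbol function on `ℚ` to a `Γ₀(N)`-invariant cusp symbol on `P¹(ℚ)` -/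

section Symbol

variable {K : Type*} [AddCommGroup K] {N : ℕ} (Φ : ℚ → K)

/-- The Möbius image of a rational point under `γ ∈ SL₂(ℤ)`, read through `Φ̃` (`Φ̃(∞) = 0`): the pole goes to `0`,
every other point to `Φ((a r + b)/(c r + d))`. [folklore] -/
theorem elim_mapGL_smul_coe (γ : SL(2, ℤ)) (r : ℚ) :
    ((mapGL ℚ γ : GL (Fin 2) ℚ) • (r : OnePoint ℚ)).elim 0 Φ =
      if ((γ 1 0 : ℤ) : ℚ) * r + ((γ 1 1 : ℤ) : ℚ) = 0 then 0
      else Φ ((((γ 0 0 : ℤ) : ℚ) * r + ((γ 0 1 : ℤ) : ℚ)) / (((γ 1 0 : ℤ) : ℚ) * r + ((γ 1 1 : ℤ) : ℚ))) := by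
  rw [OnePoint.smul_some_eq_ite]
  simp only [mapGL_rat_apply]
  split_ifs <;> rfl

/-- `Φ̃(γ∞)` is the cusp term of Manin's relation: `0` if `c = 0`, else `Φ(a/c)`. [folklore] -/
theorem elim_mapGL_smul_infty (γ : SL(2, ℤ)) :
    ((mapGL ℚ γ : GL (Fin 2) ℚ) • (OnePoint.infty : OnePoint ℚ)).elim 0 Φ =
      if (γ 1 0 : ℤ) = 0 then 0 else Φ (((γ 0 0 : ℤ) : ℚ) / ((γ 1 0 : ℤ) : ℚ)) := by
  rw [OnePoint.smul_infty_eq_ite]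
  simp only [mapGL_rat_apply, Int.cast_eq_zero]
  split_ifs <;> rfl

/-- **Manin's relation at the GOOD points of `P¹(ℚ)`**: if `γ x ≠ ∞` then `Φ̃(γ x) = Φ̃(γ ∞) + Φ̃(x)`.
[cite: Manin1972, Thm. 1.9] -/
theorem elim_mapGL_smul_of_ne
    (hΦ : ∀ (γ : CongruenceSubgroup.Gamma0 (N)) (r : ℚ), ((γ : SL(2, ℤ)) 1 0 : ℚ) * r + ((γ : SL(2, ℤ)) 1 1 : ℚ) ≠ 0 → Φ ((((γ : SL(2, ℤ)) 0 0 : ℚ) * r + ((γ : SL(2, ℤ)) 0 1 : ℚ)) / (((γ : SL(2, ℤ)) 1 0 : ℚ) * r + ((γ : SL(2, ℤ)) 1 1 : ℚ))) = (if ((γ : SL(2, ℤ)) 1 0) = 0 then 0 else Φ ((((γ : SL(2, ℤ)) 0 0 : ℚ)) / (((γ : SL(2, ℤ)) 1 0 : ℚ)))) + Φ r)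
    (γ : Gamma0 N) (x : OnePoint ℚ) (hx : (mapGL ℚ (γ : SL(2, ℤ)) : GL (Fin 2) ℚ) • x ≠ OnePoint.infty) :
    ((mapGL ℚ (γ : SL(2, ℤ)) : GL (Fin 2) ℚ) • x).elim 0 Φ =
      ((mapGL ℚ (γ : SL(2, ℤ)) : GL (Fin 2) ℚ) • (OnePoint.infty : OnePoint ℚ)).elim 0 Φ + x.elim 0 Φ := by
  induction x using OnePoint.rec with
  | infty => rw [OnePoint.elim_infty, add_zero]
  | coe r =>
    have hr : ((γ : SL(2, ℤ)) 1 0 : ℚ) * r + ((γ : SL(2, ℤ)) 1 1 : ℚ) ≠ 0 := by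
      intro h0
      apply hx
      rw [OnePoint.smul_some_eq_ite]
      simp only [mapGL_rat_apply]
      rw [if_pos h0]
    rw [elim_mapGL_smul_coe, if_neg hr, elim_mapGL_smul_infty, OnePoint.elim_some, hΦ γ r hr]

/-- **Manin's relation on ALL of `P¹(ℚ)`**: `Φ̃(γ x) = Φ̃(γ ∞) + Φ̃(x)` for every `γ ∈ Γ₀(N)` and every cusp `x`, the pole
`x = γ⁻¹∞` included (there the identity reads `Φ(γ⁻¹∞) + Φ(γ∞) = 0`, obtained from the relation for `γ⁻¹` at a good
point `γ s`). [cite: Manin1972, Thm. 1.9] -/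
theorem elim_mapGL_smul
    (hΦ : ∀ (γ : CongruenceSubgroup.Gamma0 (N)) (r : ℚ), ((γ : SL(2, ℤ)) 1 0 : ℚ) * r + ((γ : SL(2, ℤ)) 1 1 : ℚ) ≠ 0 → Φ ((((γ : SL(2, ℤ)) 0 0 : ℚ) * r + ((γ : SL(2, ℤ)) 0 1 : ℚ)) / (((γ : SL(2, ℤ)) 1 0 : ℚ) * r + ((γ : SL(2, ℤ)) 1 1 : ℚ))) = (if ((γ : SL(2, ℤ)) 1 0) = 0 then 0 else Φ ((((γ : SL(2, ℤ)) 0 0 : ℚ)) / (((γ : SL(2, ℤ)) 1 0 : ℚ)))) + Φ r)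
    (γ : Gamma0 N) (x : OnePoint ℚ) :
    ((mapGL ℚ (γ : SL(2, ℤ)) : GL (Fin 2) ℚ) • x).elim 0 Φ =
      ((mapGL ℚ (γ : SL(2, ℤ)) : GL (Fin 2) ℚ) • (OnePoint.infty : OnePoint ℚ)).elim 0 Φ + x.elim 0 Φ := by
  by_cases hx : (mapGL ℚ (γ : SL(2, ℤ)) : GL (Fin 2) ℚ) • x ≠ OnePoint.infty
  · exact elim_mapGL_smul_of_ne Φ hΦ γ x hx
  rw [not_ne_iff] at hx
  induction x using OnePoint.rec with
  | infty => rw [OnePoint.elim_infty, add_zero]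
  | coe r =>
    obtain ⟨s, hs⟩ : ∃ s : ℚ, (mapGL ℚ (γ : SL(2, ℤ)) : GL (Fin 2) ℚ) • (s : OnePoint ℚ) ≠ OnePoint.infty := by
      have hdet := det_entries (γ : SL(2, ℤ))
      by_cases hd : ((γ : SL(2, ℤ)) 1 1 : ℤ) = 0
      · refine ⟨1, fun h1 ↦ ?_⟩
        rw [OnePoint.smul_some_eq_ite] at h1
        simp only [mapGL_rat_apply, mul_one] at h1
        split_ifs at h1 with hc
        · have hc' : ((γ : SL(2, ℤ)) 1 0 : ℤ) = 0 := by
            rw [hd, Int.cast_zero, add_zero] at hc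
            exact_mod_cast hc
          rw [hd, hc', mul_zero, mul_zero, sub_zero] at hdet
          exact zero_ne_one hdet
        · exact OnePoint.coe_ne_infty _ h1
      · refine ⟨0, fun h1 ↦ ?_⟩
        rw [OnePoint.smul_some_eq_ite] at h1
        simp only [mapGL_rat_apply, mul_zero, zero_add, Int.cast_eq_zero] at h1
        rw [if_neg hd] at h1
        exact OnePoint.coe_ne_infty _ h1
    have hr : (r : OnePoint ℚ) = (mapGL ℚ ((γ⁻¹ : Gamma0 N) : SL(2, ℤ)) : GL (Fin 2) ℚ) • OnePoint.infty := by
      rw [InvMemClass.coe_inv, map_inv, eq_inv_smul_iff, hx]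
    have h1 := elim_mapGL_smul_of_ne Φ hΦ γ⁻¹ ((mapGL ℚ (γ : SL(2, ℤ)) : GL (Fin 2) ℚ) • (s : OnePoint ℚ))
      (by rw [gamma0_inv_smul_smul]; exact OnePoint.coe_ne_infty s)
    rw [gamma0_inv_smul_smul, ← hr, elim_mapGL_smul_of_ne Φ hΦ γ s hs, ← add_assoc] at h1
    -- `Φ̃(s) = (Φ̃(r) + Φ̃(γ∞)) + Φ̃(s)` forces `Φ̃(r) + Φ̃(γ∞) = 0`
    have h2 : (r : OnePoint ℚ).elim 0 Φ + ((mapGL ℚ (γ : SL(2, ℤ)) : GL (Fin 2) ℚ) • (OnePoint.infty : OnePoint ℚ)).elim 0 Φ = 0 := by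
      have h3 : (0 : K) + (s : OnePoint ℚ).elim 0 Φ =
          ((r : OnePoint ℚ).elim 0 Φ + ((mapGL ℚ (γ : SL(2, ℤ)) : GL (Fin 2) ℚ) • (OnePoint.infty : OnePoint ℚ)).elim 0 Φ) +
            (s : OnePoint ℚ).elim 0 Φ := by
        rw [zero_add]; exact h1
      exact (add_right_cancel h3).symm
    rw [hx, OnePoint.elim_infty, eq_comm, add_comm]
    exact h2

/-- **The cusp symbol of a `Γ₀(N)`-symbol function is `Γ₀(N)`-invariant**: `Ψ(γa, γb) = Ψ(a, b)` for
`Ψ(a, b) = Φ̃(b) − Φ̃(a)`. [cite: Manin1972, Thm. 1.9] -/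
theorem symbolOfFun_invariant
    (hΦ : ∀ (γ : CongruenceSubgroup.Gamma0 (N)) (r : ℚ), ((γ : SL(2, ℤ)) 1 0 : ℚ) * r + ((γ : SL(2, ℤ)) 1 1 : ℚ) ≠ 0 → Φ ((((γ : SL(2, ℤ)) 0 0 : ℚ) * r + ((γ : SL(2, ℤ)) 0 1 : ℚ)) / (((γ : SL(2, ℤ)) 1 0 : ℚ) * r + ((γ : SL(2, ℤ)) 1 1 : ℚ))) = (if ((γ : SL(2, ℤ)) 1 0) = 0 then 0 else Φ ((((γ : SL(2, ℤ)) 0 0 : ℚ)) / (((γ : SL(2, ℤ)) 1 0 : ℚ)))) + Φ r)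
    (γ : Gamma0 N) (a b : OnePoint ℚ) :
    ((mapGL ℚ (γ : SL(2, ℤ)) : GL (Fin 2) ℚ) • b).elim 0 Φ - ((mapGL ℚ (γ : SL(2, ℤ)) : GL (Fin 2) ℚ) • a).elim 0 Φ =
      b.elim 0 Φ - a.elim 0 Φ := by
  rw [elim_mapGL_smul Φ hΦ γ a, elim_mapGL_smul Φ hΦ γ b]
  abel

/-- The cusp symbol `(a, b) ↦ Φ̃(b) − Φ̃(a)` is additive. [folklore] -/
theorem symbolOfFun_isSymbol (a b c : OnePoint ℚ) :
    (b.elim 0 Φ - a.elim 0 Φ) + (c.elim 0 Φ - b.elim 0 Φ) = c.elim 0 Φ - a.elim 0 Φ := by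
  abel

end Symbol

/-! ## §2. The Hecke sums over the standard representatives -/

section Hecke

variable {K : Type*} [AddCommGroup K] {N : ℕ} (Φ : ℚ → K)

/-- `β̃ⱼ r = (r + j)/q` for `β̃ⱼ = (1 j; 0 q)`. [cite: DiamondShurman2005, §5.2 (5.2)] -/
theorem elim_heckeRepGL_some_smul_coe {q : ℕ} [NeZero q] (j : ZMod q) (r : ℚ) :
    ((heckeRepGL q (some j) : GL (Fin 2) ℚ) • (r : OnePoint ℚ)).elim 0 Φ = Φ ((r + (j.val : ℚ)) / (q : ℚ)) := by
  obtain ⟨h00, h01, h10, h11⟩ := heckeRepGL_some_apply q j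
  rw [OnePoint.smul_some_eq_ite, h00, h01, h10, h11, zero_mul, zero_add, one_mul, if_neg (NeZero.ne (q : ℚ)),
    OnePoint.elim_some]

/-- `β̃_∞ r = q r` for `β̃_∞ = diag(q, 1)`. [cite: DiamondShurman2005, §5.2 (5.2)] -/
theorem elim_heckeRepGL_none_smul_coe {q : ℕ} [NeZero q] (r : ℚ) :
    ((heckeRepGL q none : GL (Fin 2) ℚ) • (r : OnePoint ℚ)).elim 0 Φ = Φ ((q : ℚ) * r) := by
  obtain ⟨h00, h01, h10, h11⟩ := heckeRepGL_none_apply q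
  rw [OnePoint.smul_some_eq_ite, h00, h01, h10, h11, zero_mul, zero_add, if_neg one_ne_zero, add_zero, div_one,
    OnePoint.elim_some]

/-- Sums over `ZMod q` of a function of `j.val` are sums over `Fin q`. [folklore] -/
theorem sum_zmod_val_eq_sum_fin {q : ℕ} [NeZero q] (F : ℕ → K) :
    ∑ j : ZMod q, F j.val = ∑ j : Fin q, F (j : ℕ) := by
  obtain ⟨k, hk⟩ := Nat.exists_eq_succ_of_ne_zero (NeZero.ne q)
  subst hk
  rfl

/-- **The Hecke sum of `Φ̃` at a cusp** (`q` prime, `q ∤ N`, so all `q + 1` representatives occur): at `∞` it is `0`, at a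
rational `r` it is the `T_q`-sum `∑_{j<q} Φ((r + j)/q) + Φ(q r)`. [cite: DiamondShurman2005, Prop. 5.2.1] -/
theorem sum_heckeIdx_elim_smul {q : ℕ} [NeZero q] (hqN : ¬ q ∣ N) (x : OnePoint ℚ) :
    (∑ i : HeckeIdx N q, ((heckeRepGL q i.1 : GL (Fin 2) ℚ) • x).elim 0 Φ) =
      x.elim 0 (fun r ↦ (∑ j : Fin q, Φ ((r + j) / q)) + Φ (q * r)) := by
  classical
  -- reindex by `HeckeIdx N q ≃ Option (ZMod q)`
  rw [← Equiv.sum_comp (Equiv.subtypeUnivEquiv (fun (o : Option (ZMod q)) (_ : o = none) ↦ hqN)).symm]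
  simp only [Equiv.subtypeUnivEquiv_symm_apply]
  rw [Fintype.sum_option]
  induction x using OnePoint.rec with
  | infty =>
    simp only [heckeRepGL_smul_infty, OnePoint.elim_infty, Finset.sum_const_zero, add_zero]
  | coe r =>
    rw [OnePoint.elim_some, elim_heckeRepGL_none_smul_coe, add_comm]
    congr 1
    simp only [elim_heckeRepGL_some_smul_coe]
    exact sum_zmod_val_eq_sum_fin (fun j ↦ Φ ((r + (j : ℚ)) / (q : ℚ)))

end Hecke

/-! ## §3. Dilation-invariant non-Eisenstein eigen-symbols vanish -/

section Main

/-- **DILATION-INVARIANT NON-EISENSTEIN HECKE EIGEN-SYMBOLS VANISH** (Ihara's lemma for symbol functions, every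
residue characteristic `p`). `t` prime, `n ≥ 1`, `S ⊇ primes(p t N)`, `λ` NOT weight-`2` Eisenstein over `K̄`; `Φ : ℚ → K`
satisfies Manin's relation for `Γ₀(N)` and `∑_{j<q} Φ((r+j)/q) + Φ(q r) = λ(q) Φ(r)` for primes `q ∉ S`. If
`Φ(tⁿ x) = Φ(x)` for all `x` then `Φ = 0`: the boundary cochain `u(γ) = Φ̃(γ∞)` is a shift-invariant honest `T_q`-eigen
cocycle, so `u = 0` (`relativeIharaShiftVanishingBar_holds p t n`), so the symbol of `Φ` is a boundary symbol in the
`λ`-eigenspaces, hence `0` (`boundary_gen_eigen_eq_zero_finset`).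
[cite: Ribet1984ICM, Thm. 4.1 (shape: Ihara's lemma)] [cite: GreenbergVatsal2000, §3 (un-depletion via Ihara, p odd there)] -/
theorem eq_zero_of_dilationInvariant {p t n : ℕ} (hp : p.Prime) (ht : t.Prime) (hn : 1 ≤ n)
    (K : Type) [Field K] [CharP K p] {N : ℕ} [NeZero N] (S : Finset ℕ)
    (hS : ∀ q : ℕ, q.Prime → q ∣ p * t * N → q ∈ S) (lam : ℕ → K)
    (hne : ¬ IsEisensteinEigensystem 2 (fun ℓ ↦ algebraMap K (AlgebraicClosure K) (lam ℓ)))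
    (Φ : ℚ → K)
    (hΦ : ∀ (γ : CongruenceSubgroup.Gamma0 (N)) (r : ℚ), ((γ : SL(2, ℤ)) 1 0 : ℚ) * r + ((γ : SL(2, ℤ)) 1 1 : ℚ) ≠ 0 → Φ ((((γ : SL(2, ℤ)) 0 0 : ℚ) * r + ((γ : SL(2, ℤ)) 0 1 : ℚ)) / (((γ : SL(2, ℤ)) 1 0 : ℚ) * r + ((γ : SL(2, ℤ)) 1 1 : ℚ))) = (if ((γ : SL(2, ℤ)) 1 0) = 0 then 0 else Φ ((((γ : SL(2, ℤ)) 0 0 : ℚ)) / (((γ : SL(2, ℤ)) 1 0 : ℚ)))) + Φ r)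
    (hT : ∀ q : ℕ, q.Prime → q ∉ S → ∀ r : ℚ, (∑ j : Fin q, Φ ((r + j) / q)) + Φ (q * r) = lam q * Φ r)
    (hdil : ∀ x : ℚ, Φ (((t ^ n : ℕ) : ℚ) * x) = Φ x) :
    ∀ x : ℚ, Φ x = 0 := by
  classical
  haveI : NeZero t := ⟨ht.ne_zero⟩
  haveI hNt : NeZero (t ^ n) := ⟨pow_ne_zero n ht.ne_zero⟩
  -- the cusp symbol of `Φ` and its boundary cochain
  set Ψ : OnePoint ℚ → OnePoint ℚ → K := fun a b ↦ b.elim 0 Φ - a.elim 0 Φ with hΨdef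
  have hsym : ∀ a b c, Ψ a b + Ψ b c = Ψ a c := fun a b c ↦ symbolOfFun_isSymbol Φ a b c
  have hinv : ∀ γ : Gamma0 N, ∀ a b,
      Ψ ((mapGL ℚ (γ : SL(2, ℤ)) : GL (Fin 2) ℚ) • a) ((mapGL ℚ (γ : SL(2, ℤ)) : GL (Fin 2) ℚ) • b) = Ψ a b :=
    fun γ a b ↦ symbolOfFun_invariant Φ hΦ γ a b
  have hΨinf : ∀ x : OnePoint ℚ, Ψ OnePoint.infty x = x.elim 0 Φ := fun x ↦ by
    simp only [hΨdef, OnePoint.elim_infty, sub_zero]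
  set uf : Gamma0 N → Fin 1 → K :=
    fun γ _ ↦ Ψ OnePoint.infty ((mapGL ℚ (γ : SL(2, ℤ)) : GL (Fin 2) ℚ) • OnePoint.infty) with huf_def
  have huf : uf ∈ cocycles 0 N K := by
    rw [mem_cocycles_iff]
    intro γ δ
    funext k
    rw [act_zero_eq_id, LinearMap.id_apply, Pi.add_apply]
    simp only [huf_def, hΨinf]
    rw [gamma0_mul_smul, elim_mapGL_smul Φ hΦ γ, add_comm]
  set u : cocycles 0 N K := ⟨uf, huf⟩ with hu_def
  -- the Hecke sums of `Ψ` from `∞`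
  have hsumΨ : ∀ {q : ℕ} [NeZero q], q.Prime → q ∉ S → ∀ x : OnePoint ℚ,
      (∑ i : HeckeIdx N q, Ψ ((heckeRepGL q i.1 : GL (Fin 2) ℚ) • OnePoint.infty)
        ((heckeRepGL q i.1 : GL (Fin 2) ℚ) • x)) = lam q • Ψ OnePoint.infty x := by
    intro q _ hq hqS x
    have hqN : ¬ q ∣ N := fun h ↦ hqS (hS q hq (dvd_mul_of_dvd_right h _))
    simp only [hΨdef, heckeRepGL_smul_infty, OnePoint.elim_infty, sub_zero]
    rw [sum_heckeIdx_elim_smul Φ hqN x]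
    induction x using OnePoint.rec with
    | infty => rw [OnePoint.elim_infty, OnePoint.elim_infty, smul_zero]
    | coe r => rw [OnePoint.elim_some, OnePoint.elim_some, hT q hq hqS r, smul_eq_mul]
  -- `u` is an honest Hecke eigenvector away from `S`
  have heig : ∀ (q : ℕ) [NeZero q] (hq : q.Prime), q ∉ S → heckeUZ 0 N K hq u = lam q • u := by
    intro q _ hq hqS
    apply Subtype.ext
    rw [coe_heckeUZ, Submodule.coe_smul]
    have hdict := delta_hecke_cuspSymbol_eq_heckeU hq (fun i : HeckeIdx N q ↦ (heckeRepGL q i.1 : GL (Fin 2) ℚ))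
      (fun i ↦ coe_heckeRepGL q i.1) Ψ hsym hinv
    change heckeU 0 N K hq uf = lam q • uf
    rw [huf_def, ← hdict]
    funext γ k
    rw [Pi.smul_apply, Pi.smul_apply]
    exact hsumΨ hq hqS _
  have hgen : IsHeckeGenEigenvector S lam u := isHeckeGenEigenvector_of_eigenvector S lam u heig
  -- `u` is shift-invariant: `π_{tⁿ}^* u = π_1^* u`
  have hdet : (!![((t ^ n : ℕ) : ℚ), 0; 0, 1] : Matrix (Fin 2) (Fin 2) ℚ).det ≠ 0 := by
    rw [Matrix.det_fin_two_of]
    simp [ht.ne_zero]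
  set A : GL (Fin 2) ℚ := Matrix.GeneralLinearGroup.mkOfDetNeZero _ hdet with hA_def
  have hA : (A : Matrix (Fin 2) (Fin 2) ℚ) = !![((t ^ n : ℕ) : ℚ), 0; 0, 1] := rfl
  have hAx : ∀ x : OnePoint ℚ, (A • x).elim 0 Φ = x.elim 0 Φ := by
    intro x
    induction x using OnePoint.rec with
    | infty => rw [diag_smul_infty A hA]
    | coe r =>
      have h00 : (A : GL (Fin 2) ℚ) 0 0 = ((t ^ n : ℕ) : ℚ) := by simp [hA]
      have h01 : (A : GL (Fin 2) ℚ) 0 1 = 0 := by simp [hA]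
      have h10 : (A : GL (Fin 2) ℚ) 1 0 = 0 := by simp [hA]
      have h11 : (A : GL (Fin 2) ℚ) 1 1 = 1 := by simp [hA]
      rw [OnePoint.smul_some_eq_ite, h00, h01, h10, h11, zero_mul, zero_add, if_neg one_ne_zero, add_zero, div_one,
        OnePoint.elim_some, OnePoint.elim_some, hdil]
  have hshift : degeneracyPullback 0 N (N * t ^ n) (t ^ n) K dvd_rfl (u : Gamma0 N → Fin 1 → K) =
      degeneracyPullback 0 N (N * t ^ n) 1 K (by simp) (u : Gamma0 N → Fin 1 → K) := by
    funext γ k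
    rw [degeneracyPullback_zero_apply, degeneracyPullback_zero_apply]
    change Ψ OnePoint.infty _ = Ψ OnePoint.infty _
    rw [← delta_shift_cuspSymbol (h := dvd_rfl) A hA Ψ γ, ← delta_restrict_cuspSymbol Ψ (by simp) γ,
      diag_smul_infty A hA, hΨinf, hΨinf, hAx]
  -- relative Ihara (cell bsd-f2-manin): `u = 0`
  have hu0 : u = 0 :=
    ManinLocalTwoThree.relativeIharaShiftVanishingBar_holds p t n hp ht hn K N S lam u hS hgen hne hshift
  have hδ : ∀ γ : Gamma0 N, Ψ OnePoint.infty ((mapGL ℚ (γ : SL(2, ℤ)) : GL (Fin 2) ℚ) • OnePoint.infty) = 0 := by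
    intro γ
    have h := congrArg (fun v : cocycles 0 N K ↦ (v : Gamma0 N → Fin 1 → K) γ 0) hu0
    simpa [hu_def, huf_def] using h
  -- so `Ψ` is a boundary symbol of level `N` …
  obtain ⟨w, hw, hΨw⟩ := exists_boundary_of_delta_eq_zero N Ψ hsym hinv hδ
  have hmem : Ψ ∈ (cuspInvariants N K).map (boundaryOf K) := by
    refine ⟨w, (mem_cuspInvariants N K w).mpr hw, ?_⟩
    funext a b
    rw [boundaryOf_apply, hΨw]
  -- … lying in the `λ`-eigenspaces of the `T_r`, hence zero (E-es-30)
  have hSN : ∀ q : ℕ, q.Prime → q ∣ N → q ∈ S := fun q hq h ↦ hS q hq (dvd_mul_of_dvd_right h _)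
  obtain ⟨F, hF⟩ := boundary_gen_eigen_eq_zero_finset N S hSN lam hne
  have hΨ0 : Ψ = 0 := by
    refine hF Ψ hmem fun i _ ↦ ?_
    haveI : NeZero i.1 := ⟨i.2.1.ne_zero⟩
    rw [Module.End.mem_maxGenEigenspace]
    refine ⟨1, ?_⟩
    rw [pow_one, LinearMap.sub_apply, LinearMap.smul_apply, Module.End.one_apply, sub_eq_zero]
    funext a b
    rw [symbolHecke_apply, Pi.smul_apply, Pi.smul_apply]
    have e : ∀ i' : HeckeIdx N i.1, Ψ ((heckeRepGL i.1 i'.1 : GL (Fin 2) ℚ) • a) ((heckeRepGL i.1 i'.1 : GL (Fin 2) ℚ) • b) =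
        Ψ ((heckeRepGL i.1 i'.1 : GL (Fin 2) ℚ) • OnePoint.infty) ((heckeRepGL i.1 i'.1 : GL (Fin 2) ℚ) • b) -
          Ψ ((heckeRepGL i.1 i'.1 : GL (Fin 2) ℚ) • OnePoint.infty) ((heckeRepGL i.1 i'.1 : GL (Fin 2) ℚ) • a) := by
      intro i'
      rw [← hsym ((heckeRepGL i.1 i'.1 : GL (Fin 2) ℚ) • OnePoint.infty) ((heckeRepGL i.1 i'.1 : GL (Fin 2) ℚ) • a)
        ((heckeRepGL i.1 i'.1 : GL (Fin 2) ℚ) • b)]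
      abel
    rw [Finset.sum_congr rfl fun i' _ ↦ e i', Finset.sum_sub_distrib, hsumΨ i.2.1 i.2.2, hsumΨ i.2.1 i.2.2,
      ← smul_sub, ← hsym OnePoint.infty a b]
    congr 1
    abel
  intro x
  have h := congrFun (congrFun hΨ0 OnePoint.infty) (x : OnePoint ℚ)
  rw [hΨinf] at h
  simpa using h

end Main

/-! ## §4. Characteristic `2`: a nonzero eigen-symbol is not killed by a depletion factor `1 + c₁[t] + c₂[t²]`, `cᵢ ∈ {0,1}` -/

section CharTwo

/-- **The un-depletion step at one prime (characteristic `2`).** With `K, N, S, λ, Φ` as in `eq_zero_of_dilationInvariant`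
(`p = 2`, `S ⊇ primes(2 t N)`): if `Φ ≢ 0` then `x ↦ Φ(x) + c₁ Φ(t x) + c₂ Φ(t² x) ≢ 0` for `c₁, c₂ ∈ {0,1}` — each of
`1, 1+B, 1+B², 1+B+B²` divides some `1 + Bⁿ` (`n = 1, 1, 2, 3`) in `𝔽₂[B]`, so a killed `Φ` is `tⁿ`-dilation invariant.
[cite: GreenbergVatsal2000, §3 (un-depletion via Ihara; p odd there)] -/
theorem exists_ne_zero_depletionFactor {t : ℕ} (ht : t.Prime)
    (K : Type) [Field K] [CharP K 2] {N : ℕ} [NeZero N] (S : Finset ℕ)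
    (hS : ∀ q : ℕ, q.Prime → q ∣ 2 * t * N → q ∈ S) (lam : ℕ → K)
    (hne : ¬ IsEisensteinEigensystem 2 (fun ℓ ↦ algebraMap K (AlgebraicClosure K) (lam ℓ)))
    (Φ : ℚ → K)
    (hΦ : ∀ (γ : CongruenceSubgroup.Gamma0 (N)) (r : ℚ), ((γ : SL(2, ℤ)) 1 0 : ℚ) * r + ((γ : SL(2, ℤ)) 1 1 : ℚ) ≠ 0 → Φ ((((γ : SL(2, ℤ)) 0 0 : ℚ) * r + ((γ : SL(2, ℤ)) 0 1 : ℚ)) / (((γ : SL(2, ℤ)) 1 0 : ℚ) * r + ((γ : SL(2, ℤ)) 1 1 : ℚ))) = (if ((γ : SL(2, ℤ)) 1 0) = 0 then 0 else Φ ((((γ : SL(2, ℤ)) 0 0 : ℚ)) / (((γ : SL(2, ℤ)) 1 0 : ℚ)))) + Φ r)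
    (hT : ∀ q : ℕ, q.Prime → q ∉ S → ∀ r : ℚ, (∑ j : Fin q, Φ ((r + j) / q)) + Φ (q * r) = lam q * Φ r)
    (hΦ0 : ∃ x : ℚ, Φ x ≠ 0) {c₁ c₂ : K} (hc₁ : c₁ = 0 ∨ c₁ = 1) (hc₂ : c₂ = 0 ∨ c₂ = 1) :
    ∃ x : ℚ, Φ x + c₁ * Φ ((t : ℚ) * x) + c₂ * Φ ((t : ℚ) ^ 2 * x) ≠ 0 := by
  by_contra hall
  push Not at hall
  obtain ⟨x₀, hx₀⟩ := hΦ0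
  apply hx₀
  -- in each of the four cases `Φ` is invariant under dilation by `tⁿ` for some `n ≥ 1`
  have key : ∃ n : ℕ, 1 ≤ n ∧ ∀ x : ℚ, Φ (((t ^ n : ℕ) : ℚ) * x) = Φ x := by
    rcases hc₁ with rfl | rfl <;> rcases hc₂ with rfl | rfl
    · -- `Φ = 0` outright
      refine ⟨1, le_rfl, fun x ↦ ?_⟩
      have h := hall x
      have h' := hall (((t ^ 1 : ℕ) : ℚ) * x)
      simp only [zero_mul, add_zero] at h h'
      rw [h, h']
    · -- `Φ(x) + Φ(t² x) = 0`
      refine ⟨2, by norm_num, fun x ↦ ?_⟩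
      have h := hall x
      simp only [zero_mul, add_zero, one_mul] at h
      rw [Nat.cast_pow]
      exact (CharTwo.add_eq_zero.mp h).symm
    · -- `Φ(x) + Φ(t x) = 0`
      refine ⟨1, le_rfl, fun x ↦ ?_⟩
      have h := hall x
      simp only [one_mul, zero_mul, add_zero] at h
      rw [pow_one]
      exact (CharTwo.add_eq_zero.mp h).symm
    · -- `Φ(x) + Φ(t x) + Φ(t² x) = 0`, hence `Φ(t³ x) = Φ(x)`
      refine ⟨3, by norm_num, fun x ↦ ?_⟩
      have h := hall x
      have h' := hall ((t : ℚ) * x)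
      simp only [one_mul] at h h'
      rw [Nat.cast_pow]
      have e2 : (t : ℚ) * ((t : ℚ) * x) = (t : ℚ) ^ 2 * x := by ring
      have e3 : (t : ℚ) ^ 2 * ((t : ℚ) * x) = (t : ℚ) ^ 3 * x := by ring
      rw [e2, e3] at h'
      -- `h : Φ x + Φ(t x) + Φ(t² x) = 0`, `h' : Φ(t x) + Φ(t² x) + Φ(t³ x) = 0`
      have hsum : Φ x + Φ ((t : ℚ) ^ 3 * x) =
          (Φ x + Φ ((t : ℚ) * x) + Φ ((t : ℚ) ^ 2 * x)) + (Φ ((t : ℚ) * x) + Φ ((t : ℚ) ^ 2 * x) + Φ ((t : ℚ) ^ 3 * x)) := by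
        have e : Φ ((t : ℚ) * x) + Φ ((t : ℚ) ^ 2 * x) + (Φ ((t : ℚ) * x) + Φ ((t : ℚ) ^ 2 * x)) = 0 :=
          CharTwo.add_self_eq_zero _
        linear_combination -e
      rw [h, h', add_zero] at hsum
      exact (CharTwo.add_eq_zero.mp hsum).symm
  obtain ⟨n, hn, hdil⟩ := key
  exact eq_zero_of_dilationInvariant Nat.prime_two ht hn K S hS lam hne Φ hΦ hT hdil x₀

end CharTwo

end Summit.BirchSwinnertonDyer.BirchSwinnertonDyer.Theorems.MazurTateCongruenceAtTwoR

end
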